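import Summits.HodgeConjecture.HodgeConjecture.Theorems.ELineTransportELineConnectivityRSchur

/-!
# Route `ELineTransport` — support item `ELineConnectivityR` (stmt-HodgeConjecture-13981), part 4:
# the endomorphism algebra of a simple K3-type Hodge structure is a field of degree `2` or `22`

Abstract algebra of the "End-bad = CM points" step of `Theses.ELineTransport.ELineConnectivityR`.
Let `R ⊆ M₂₂(ℚ)` be a `ℚ`-subalgebra and `x ∈ ℂ²²` a common eigenvector of (the complexifications
of) all `A ∈ R`, such that `A x = 0 ⇒ A = 0` and every non-zero `A ∈ R` is invertible with
`A⁻¹ ∈ R` (Schur, part 3), and let `J ∈ R` with `J² = m`, `m` a non-square. Then: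

* `hodgeAlg_isField` — `R` is a (commutative) field: the eigenvalue map `R → ℂ` is an injective
  ring homomorphism;
* `finrank_dvd_of_isField` — `[R : ℚ] ∣ 22` (tower law: `ℚ²²` is an `R`-vector space);
* `isSquare_of_odd_finrank` — `[R : ℚ]` is even (determinant of multiplication by `J`:
  `det(J)² = m^{[R:ℚ]}`, and `m` is not a square), so `[R : ℚ] ∈ {2, 22}`;
* `[R : ℚ] = 2` ⇒ `R = ℚ + ℚ J`; `[R : ℚ] = 22` ⇒ a primitive element `θ ∈ R` has irreducible,
  hence separable, characteristic polynomial, so its complex eigenspaces are lines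
  (`eigenline_of_irreducible_charpoly`), and `x` spans one of them;
* `hodgeAlg_dichotomy` — the resulting dichotomy: either every `A ∈ R` is `a + bJ`, or `ℂx` is an
  eigenline of some `θ ∈ R` (a "CM point": countably many).

No definitions, no named facts, no sorry.
-/

-- `Summit.HodgeConjecture.HodgeConjecture.…` (summit = problem) duplicates a namespace component by design (D-0017).
set_option linter.dupNamespace false

noncomputable section

open Matrix Module Polynomial

namespace Summit.HodgeConjecture.HodgeConjecture.Theorems

namespace ELineConnR

/-! ### Commutativity and the field structure -/

/-- The complexification of a product of rational matrices acts as the composite. [folklore] -/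
theorem ratMap_mul_mulVec (A B : Matrix (Fin 22) (Fin 22) ℚ) (v : Fin 22 → ℂ) :
    ((A * B).map (fun t : ℚ => (t : ℂ))) *ᵥ v =
      (A.map (fun t : ℚ => (t : ℂ))) *ᵥ ((B.map (fun t : ℚ => (t : ℂ))) *ᵥ v) := by
  rw [ratMap_mul, Matrix.mulVec_mulVec]

/-- **Commutativity.** A subalgebra of `M₂₂(ℚ)` with a common complex eigenvector `x` on which
`A x = 0 ⇒ A = 0` is commutative. [folklore] -/
theorem hodgeAlg_comm (R : Subalgebra ℚ (Matrix (Fin 22) (Fin 22) ℚ)) (x : Fin 22 → ℂ)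
    (hev : ∀ A ∈ R, ∃ c : ℂ, (A.map (fun t : ℚ => (t : ℂ))) *ᵥ x = c • x)
    (h0 : ∀ A ∈ R, (A.map (fun t : ℚ => (t : ℂ))) *ᵥ x = 0 → A = 0)
    {A B : Matrix (Fin 22) (Fin 22) ℚ} (hA : A ∈ R) (hB : B ∈ R) : A * B = B * A := by
  obtain ⟨a, ha⟩ := hev A hA
  obtain ⟨b, hb⟩ := hev B hB
  have hmem : A * B - B * A ∈ R := R.sub_mem (R.mul_mem hA hB) (R.mul_mem hB hA)
  have hzero : ((A * B - B * A).map (fun t : ℚ => (t : ℂ))) *ᵥ x = 0 := by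
    rw [Matrix.map_sub _ (fun a₁ a₂ => Rat.cast_sub a₁ a₂), Matrix.sub_mulVec, ratMap_mul_mulVec,
      ratMap_mul_mulVec, hb, ha,
      Matrix.mulVec_smul, Matrix.mulVec_smul, ha, hb, smul_smul, smul_smul, mul_comm, sub_self]
  exact sub_eq_zero.1 (h0 _ hmem hzero)

/-- **The endomorphism algebra is a field.** [folklore] -/
theorem hodgeAlg_isField (R : Subalgebra ℚ (Matrix (Fin 22) (Fin 22) ℚ)) (x : Fin 22 → ℂ)
    (hev : ∀ A ∈ R, ∃ c : ℂ, (A.map (fun t : ℚ => (t : ℂ))) *ᵥ x = c • x)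
    (h0 : ∀ A ∈ R, (A.map (fun t : ℚ => (t : ℂ))) *ᵥ x = 0 → A = 0)
    (hunit : ∀ A ∈ R, A ≠ 0 → IsUnit A ∧ A⁻¹ ∈ R) : IsField R := by
  refine ⟨⟨0, 1, ?_⟩, ?_, ?_⟩
  · intro h
    have := congrArg Subtype.val h
    simp at this
  · intro a b
    exact Subtype.ext (hodgeAlg_comm R x hev h0 a.2 b.2)
  · intro a ha
    have ha' : (a : Matrix (Fin 22) (Fin 22) ℚ) ≠ 0 := fun h => ha (Subtype.ext h)
    obtain ⟨hu, hinv⟩ := hunit a a.2 ha'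
    refine ⟨⟨(a : Matrix (Fin 22) (Fin 22) ℚ)⁻¹, hinv⟩, Subtype.ext ?_⟩
    simp only [Subalgebra.coe_mul, Subalgebra.coe_one]
    exact Matrix.mul_nonsing_inv _ ((Matrix.isUnit_iff_isUnit_det _).1 hu)

/-! ### The degree is `2` or `22` -/

/-- **Tower law**: the dimension of a subfield of `M₂₂(ℚ)` divides `22`. [folklore] -/
theorem finrank_dvd_of_isField (R : Subalgebra ℚ (Matrix (Fin 22) (Fin 22) ℚ)) (hR : IsField R) :
    finrank ℚ R ∣ 22 := by
  letI : Field R := hR.toField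
  have h := Module.finrank_mul_finrank ℚ R (Fin 22 → ℚ)
  have h22 : finrank ℚ (Fin 22 → ℚ) = 22 := by simp
  rw [h22] at h
  exact Dvd.intro _ h

/-- **Determinant trick**: if a finite-dimensional `ℚ`-algebra of odd dimension contains `J`
with `J² = m`, then `m` is a rational square (`det(J·)² = m^{dim}`). [folklore] -/
theorem isSquare_of_odd_finrank (S : Type) [Ring S] [Algebra ℚ S] [Module.Finite ℚ S] (J : S)
    (m : ℚ) (hJ : J * J = algebraMap ℚ S m) (hodd : Odd (finrank ℚ S)) : IsSquare m := by
  set L : S →ₗ[ℚ] S := LinearMap.mulLeft ℚ J with hL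
  have hLL : L * L = m • LinearMap.id := by
    ext r
    simp [hL, Module.End.mul_apply, ← mul_assoc, hJ, Algebra.smul_def]
  have hdet : LinearMap.det L * LinearMap.det L = m ^ finrank ℚ S := by
    rw [← LinearMap.det_comp, show L ∘ₗ L = L * L from rfl, hLL, LinearMap.det_smul,
      LinearMap.det_id, mul_one]
  obtain ⟨k, hk⟩ := hodd
  rw [hk, pow_succ, pow_mul] at hdet
  by_cases hm : m = 0
  · exact ⟨0, by simp [hm]⟩
  · refine ⟨LinearMap.det L / m ^ k, ?_⟩
    have hmk : m ^ k ≠ 0 := pow_ne_zero _ hm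
    rw [div_mul_div_comm, eq_div_iff (mul_ne_zero hmk hmk), hdet]
    ring

/-- **The degree dichotomy**: a subfield of `M₂₂(ℚ)` containing `J` with `J² = m`, `m` a
non-square natural number, has dimension `2` or `22` over `ℚ`. [folklore] -/
theorem finrank_eq_two_or_eq (R : Subalgebra ℚ (Matrix (Fin 22) (Fin 22) ℚ)) (hR : IsField R)
    {m : ℕ} (hm : ¬ IsSquare m) {J : Matrix (Fin 22) (Fin 22) ℚ} (hJR : J ∈ R)
    (hJ2 : J * J = (m : ℚ) • (1 : Matrix (Fin 22) (Fin 22) ℚ)) :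
    finrank ℚ R = 2 ∨ finrank ℚ R = 22 := by
  haveI : FiniteDimensional ℚ R := inferInstanceAs (FiniteDimensional ℚ R.toSubmodule)
  have hdvd := finrank_dvd_of_isField R hR
  have heven : ¬ Odd (finrank ℚ R) := by
    intro hodd
    have hsq := isSquare_of_odd_finrank R (⟨J, hJR⟩ : R) (m : ℚ) (Subtype.ext (by
      simp only [Subalgebra.coe_mul, Algebra.algebraMap_eq_smul_one]
      exact hJ2)) hodd
    exact hm (Rat.isSquare_natCast_iff.1 hsq)
  have hle : finrank ℚ R ≤ 22 := Nat.le_of_dvd (by norm_num) hdvd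
  rw [Nat.not_odd_iff_even] at heven
  obtain ⟨k, hk⟩ := heven
  obtain ⟨j, hj⟩ := hdvd
  interval_cases h : finrank ℚ R <;> omega

/-! ### Degree `2`: `R = ℚ + ℚJ` -/

/-- If `[R : ℚ] = 2` and `J ∈ R` is not a scalar, every element of `R` is `a + bJ`. [folklore] -/
theorem eq_lincomb_of_finrank_two (R : Subalgebra ℚ (Matrix (Fin 22) (Fin 22) ℚ))
    {J : Matrix (Fin 22) (Fin 22) ℚ} (hJR : J ∈ R)
    (hJs : ∀ a : ℚ, J ≠ a • (1 : Matrix (Fin 22) (Fin 22) ℚ)) (hd : finrank ℚ R = 2)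
    {A : Matrix (Fin 22) (Fin 22) ℚ} (hA : A ∈ R) :
    ∃ a b : ℚ, A = a • (1 : Matrix (Fin 22) (Fin 22) ℚ) + b • J := by
  haveI : FiniteDimensional ℚ R := inferInstanceAs (FiniteDimensional ℚ R.toSubmodule)
  -- the pair `(1, J)` is linearly independent
  have hind : LinearIndependent ℚ ![(1 : Matrix (Fin 22) (Fin 22) ℚ), J] := by
    rw [LinearIndependent.pair_iff]
    intro s t hst
    by_cases ht : t = 0
    · rw [ht, zero_smul, add_zero, smul_eq_zero] at hst
      rcases hst with hs | h1
      · exact ⟨hs, ht⟩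
      · exact absurd h1 one_ne_zero
    · exfalso
      apply hJs (-(s / t))
      have : t • J = -(s • (1 : Matrix (Fin 22) (Fin 22) ℚ)) := eq_neg_of_add_eq_zero_right hst
      calc J = t⁻¹ • (t • J) := by rw [smul_smul, inv_mul_cancel₀ ht, one_smul]
        _ = -(s / t) • 1 := by rw [this, smul_neg, smul_smul, neg_smul, div_eq_inv_mul]
  set S : Submodule ℚ (Matrix (Fin 22) (Fin 22) ℚ) :=
    Submodule.span ℚ (Set.range ![(1 : Matrix (Fin 22) (Fin 22) ℚ), J]) with hS
  have hSle : S ≤ Subalgebra.toSubmodule R := by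
    rw [hS, Submodule.span_le]
    rintro _ ⟨i, rfl⟩
    fin_cases i
    · exact R.one_mem
    · exact hJR
  have hSdim : finrank ℚ S = 2 := by
    rw [hS, finrank_span_eq_card hind]; simp
  have hSeq : S = Subalgebra.toSubmodule R :=
    Submodule.eq_of_le_of_finrank_eq hSle (by rw [hSdim, Subalgebra.finrank_toSubmodule, hd])
  have hAS : A ∈ S := by rw [hSeq]; exact hA
  rw [hS, Matrix.range_cons, Matrix.range_cons, Matrix.range_empty, Set.union_empty,
    Set.singleton_union] at hAS
  obtain ⟨a, b, hab⟩ := Submodule.mem_span_pair.1 hAS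
  exact ⟨a, b, hab.symm⟩

/-! ### Degree `22`: a primitive element has irreducible characteristic polynomial -/

/-- If `[R : ℚ] = 22` for a subfield `R ⊆ M₂₂(ℚ)`, some `θ ∈ R` has irreducible characteristic
polynomial (a primitive element: its minimal polynomial has degree `22`). [folklore] -/
theorem exists_irreducible_charpoly (R : Subalgebra ℚ (Matrix (Fin 22) (Fin 22) ℚ))
    (hR : IsField R) (hd : finrank ℚ R = 22) :
    ∃ θ : Matrix (Fin 22) (Fin 22) ℚ, θ ∈ R ∧ Irreducible θ.charpoly := by
  letI : Field R := hR.toField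
  haveI : FiniteDimensional ℚ R := inferInstanceAs (FiniteDimensional ℚ R.toSubmodule)
  obtain ⟨α, hα⟩ := Field.exists_primitive_element ℚ R
  have hint : IsIntegral ℚ α := .of_finite ℚ α
  have hdeg : (minpoly ℚ α).natDegree = 22 := by
    rw [← IntermediateField.adjoin.finrank hint, hα, IntermediateField.finrank_top', hd]
  have hmin : minpoly ℚ (α : Matrix (Fin 22) (Fin 22) ℚ) = minpoly ℚ α :=
    minpoly.algHom_eq R.val Subtype.val_injective α
  refine ⟨α, α.2, ?_⟩
  have hdvd := Matrix.minpoly_dvd_charpoly (α : Matrix (Fin 22) (Fin 22) ℚ)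
  have heq : (α : Matrix (Fin 22) (Fin 22) ℚ).charpoly =
      minpoly ℚ (α : Matrix (Fin 22) (Fin 22) ℚ) :=
    Polynomial.eq_of_monic_of_dvd_of_natDegree_le (minpoly.monic (Matrix.isIntegral _))
      (Matrix.charpoly_monic _) hdvd (by simp [Matrix.charpoly_natDegree_eq_dim, hmin, hdeg])
  rw [heq, hmin]
  exact minpoly.irreducible hint

/-- **Eigenlines.** A rational matrix with irreducible characteristic polynomial has
one-dimensional complex eigenspaces (irreducible ⇒ separable ⇒ `22` distinct eigenvalues, whose
eigenvectors are independent). [folklore] -/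
theorem eigenline_of_irreducible_charpoly (θ : Matrix (Fin 22) (Fin 22) ℚ)
    (hirr : Irreducible θ.charpoly) (μ : ℂ) {x y : Fin 22 → ℂ} (hx : x ≠ 0)
    (hθx : (θ.map (fun t : ℚ => (t : ℂ))) *ᵥ x = μ • x)
    (hθy : (θ.map (fun t : ℚ => (t : ℂ))) *ᵥ y = μ • y) :
    ∃ c : ℂ, y = c • x := by
  have hmap : θ.map (fun t : ℚ => (t : ℂ)) = θ.map (algebraMap ℚ ℂ) := by
    ext i j
    exact (eq_ratCast (algebraMap ℚ ℂ) (θ i j)).symm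
  rw [hmap] at hθx hθy
  set f : Module.End ℂ (Fin 22 → ℂ) := (θ.map (algebraMap ℚ ℂ)).toLin' with hf
  set p : ℂ[X] := θ.charpoly.map (algebraMap ℚ ℂ) with hp
  have hfch : f.charpoly = p := by
    rw [hf, Matrix.charpoly_toLin', Matrix.charpoly_map]
  have hsep : p.Separable := (hirr.separable).map
  have hsplit : p.Splits := IsAlgClosed.splits p
  have hp0 : p ≠ 0 := hsep.ne_zero
  have hdegp : p.natDegree = 22 := by
    rw [hp, Polynomial.natDegree_map, Matrix.charpoly_natDegree_eq_dim]; simp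
  have hfx : f.HasEigenvector μ x := by
    refine ⟨?_, hx⟩
    rw [Module.End.mem_eigenspace_iff, hf, Matrix.toLin'_apply, hθx]
  have hyE : y ∈ f.eigenspace μ := by
    rw [Module.End.mem_eigenspace_iff, hf, Matrix.toLin'_apply, hθy]
  -- the `22` roots; `μ` is one of them
  set T : Finset ℂ := p.roots.toFinset with hT
  have hcard : T.card = 22 := by
    rw [hT, Multiset.toFinset_card_of_nodup (nodup_roots hsep), ← hsplit.natDegree_eq_card_roots,
      hdegp]
  have hroot : ∀ ν ∈ T, f.HasEigenvalue ν := by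
    intro ν hν
    rw [Module.End.hasEigenvalue_iff_isRoot_charpoly, hfch]
    exact (mem_roots hp0).1 (Multiset.mem_toFinset.1 hν)
  have hμT : μ ∈ T := by
    rw [hT, Multiset.mem_toFinset, mem_roots hp0, ← hfch,
      ← Module.End.hasEigenvalue_iff_isRoot_charpoly]
    exact Module.End.hasEigenvalue_of_hasEigenvector hfx
  -- eigenvectors for the other `21` roots
  set T' : Finset ℂ := T.erase μ with hT'
  have hcard' : T'.card = 21 := by rw [hT', Finset.card_erase_of_mem hμT, hcard]
  have hev : ∀ ν : T', ∃ v : Fin 22 → ℂ, f.HasEigenvector ν v := fun ν =>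
    (hroot ν (Finset.mem_of_mem_erase ν.2)).exists_hasEigenvector
  choose v hv using hev
  -- a `μ`-eigenvector is not in their span
  have hkey : ∀ u : Fin 22 → ℂ, f.HasEigenvector μ u → u ∉ Submodule.span ℂ (Set.range v) := by
    intro u hu huS
    have hind : LinearIndependent ℂ (fun o : Option T' => o.elim u v) := by
      refine Module.End.eigenvectors_linearIndependent' f
        (fun o : Option T' => o.elim μ (fun ν => (ν : ℂ))) ?_ _ ?_
      · intro a b hab
        cases a with
        | none =>
          cases b with
          | none => rfl
          | some ν =>
            exfalso
            have : (ν : ℂ) ≠ μ := Finset.ne_of_mem_erase ν.2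
            exact this (by simpa using hab.symm)
        | some ν =>
          cases b with
          | none =>
            exfalso
            have : (ν : ℂ) ≠ μ := Finset.ne_of_mem_erase ν.2
            exact this (by simpa using hab)
          | some ν' =>
            have : (ν : ℂ) = ν' := by simpa using hab
            rw [Subtype.ext this]
      · intro o
        cases o with
        | none => simpa using hu
        | some ν => simpa using hv ν
    have hnot := hind.notMem_span_image (s := {none}ᶜ) (x := none) (by simp)
    apply hnot
    have himg : (fun o : Option T' => o.elim u v) '' {none}ᶜ = Set.range v := by
      ext w
      simp only [Set.mem_image, Set.mem_compl_iff, Set.mem_singleton_iff, Set.mem_range]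
      constructor
      · rintro ⟨o, ho, rfl⟩
        cases o with
        | none => exact absurd rfl ho
        | some ν => exact ⟨ν, rfl⟩
      · rintro ⟨ν, rfl⟩
        exact ⟨some ν, by simp, rfl⟩
    rw [himg]
    simpa using huS
  -- dimension count
  have hvind : LinearIndependent ℂ v := by
    refine Module.End.eigenvectors_linearIndependent' f (fun ν : T' => (ν : ℂ)) ?_ _ hv
    intro a b hab; exact Subtype.ext hab
  have hspan : finrank ℂ (Submodule.span ℂ (Set.range v)) = 21 := by
    rw [finrank_span_eq_card hvind]; simp [hcard']
  have hinf : f.eigenspace μ ⊓ Submodule.span ℂ (Set.range v) = ⊥ := by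
    rw [eq_bot_iff]
    intro u hu
    rw [Submodule.mem_bot]
    by_contra hu0
    exact hkey u ⟨(Submodule.mem_inf.1 hu).1, hu0⟩ (Submodule.mem_inf.1 hu).2
  have hdim := Submodule.finrank_sup_add_finrank_inf_eq (f.eigenspace μ)
    (Submodule.span ℂ (Set.range v))
  rw [hinf, finrank_bot, add_zero, hspan] at hdim
  have hle : finrank ℂ ↥(f.eigenspace μ ⊔ Submodule.span ℂ (Set.range v)) ≤ 22 := by
    calc _ ≤ finrank ℂ (Fin 22 → ℂ) := Submodule.finrank_le _
      _ = 22 := by simp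
  have h1 : finrank ℂ (f.eigenspace μ) ≤ 1 := by omega
  have hle1 : f.eigenspace μ ≤ Submodule.span ℂ {x} := by
    have hxspan : Submodule.span ℂ {x} ≤ f.eigenspace μ :=
      (Submodule.span_singleton_le_iff_mem _ _).2 hfx.1
    have hfin1 : finrank ℂ (Submodule.span ℂ ({x} : Set (Fin 22 → ℂ))) = 1 :=
      finrank_span_singleton hx
    exact (Submodule.eq_of_le_of_finrank_le hxspan (by rw [hfin1]; exact h1)).symm.le
  obtain ⟨c, hc⟩ := Submodule.mem_span_singleton.1 (hle1 hyE)
  exact ⟨c, hc.symm⟩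

/-- The eigenvalue of a rational matrix on a non-zero complex vector is a root of the complex
characteristic polynomial (so it lies in the finite root list). [folklore] -/
theorem mem_roots_charpoly_of_eigen (θ : Matrix (Fin 22) (Fin 22) ℚ) {μ : ℂ} {x : Fin 22 → ℂ}
    (hx : x ≠ 0) (hθx : (θ.map (fun t : ℚ => (t : ℂ))) *ᵥ x = μ • x) :
    μ ∈ ((θ.map (fun t : ℚ => (t : ℂ))).charpoly).roots := by
  set f : Module.End ℂ (Fin 22 → ℂ) := (θ.map (fun t : ℚ => (t : ℂ))).toLin' with hf
  have hfx : f.HasEigenvector μ x :=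
    ⟨by rw [Module.End.mem_eigenspace_iff, hf, Matrix.toLin'_apply, hθx], hx⟩
  have h := Module.End.hasEigenvalue_of_hasEigenvector hfx
  rw [Module.End.hasEigenvalue_iff_isRoot_charpoly, hf, Matrix.charpoly_toLin'] at h
  exact (Polynomial.mem_roots (Matrix.charpoly_monic _).ne_zero).2 h

/-! ### The dichotomy -/

/-- **End-bad points are CM points.** For a `ℚ`-subalgebra `R ⊆ M₂₂(ℚ)` with common complex
eigenvector `x ≠ 0` such that `A x = 0 ⇒ A = 0` and non-zero elements are invertible inside `R`,
containing `J` with `J² = m` (`m` a non-square): EITHER every `A ∈ R` is `a·1 + b·J`, OR `ℂx` is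
the full eigenspace of some `θ ∈ R` for its eigenvalue on `x`. [folklore] -/
theorem hodgeAlg_dichotomy {m : ℕ} (hm : ¬ IsSquare m) {J : Matrix (Fin 22) (Fin 22) ℚ}
    (hJ2 : J * J = (m : ℚ) • (1 : Matrix (Fin 22) (Fin 22) ℚ))
    (R : Subalgebra ℚ (Matrix (Fin 22) (Fin 22) ℚ)) (hJR : J ∈ R) {x : Fin 22 → ℂ} (hx : x ≠ 0)
    (hev : ∀ A ∈ R, ∃ c : ℂ, (A.map (fun t : ℚ => (t : ℂ))) *ᵥ x = c • x)
    (h0 : ∀ A ∈ R, (A.map (fun t : ℚ => (t : ℂ))) *ᵥ x = 0 → A = 0)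
    (hunit : ∀ A ∈ R, A ≠ 0 → IsUnit A ∧ A⁻¹ ∈ R) :
    (∀ A ∈ R, ∃ a b : ℚ, A = a • (1 : Matrix (Fin 22) (Fin 22) ℚ) + b • J) ∨
    (∃ θ ∈ R, ∃ μ : ℂ, (θ.map (fun t : ℚ => (t : ℂ))) *ᵥ x = μ • x ∧
      ∀ y : Fin 22 → ℂ, (θ.map (fun t : ℚ => (t : ℂ))) *ᵥ y = μ • y → ∃ c : ℂ, y = c • x) := by
  have hR : IsField R := hodgeAlg_isField R x hev h0 hunit
  -- `J` is not a scalar since `m` is not a square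
  have hJs : ∀ a : ℚ, J ≠ a • (1 : Matrix (Fin 22) (Fin 22) ℚ) := by
    intro a hJa
    apply hm
    rw [← Rat.isSquare_natCast_iff]
    refine ⟨a, ?_⟩
    have h := congrFun (congrFun hJ2 0) 0
    rw [hJa, smul_mul_smul_comm, mul_one] at h
    simpa using h.symm
  rcases finrank_eq_two_or_eq R hR hm hJR hJ2 with h2 | h22
  · exact Or.inl fun A hA => eq_lincomb_of_finrank_two R hJR hJs h2 hA
  · right
    obtain ⟨θ, hθR, hirr⟩ := exists_irreducible_charpoly R hR h22
    obtain ⟨μ, hμ⟩ := hev θ hθR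
    exact ⟨θ, hθR, μ, hμ, fun y hy => eigenline_of_irreducible_charpoly θ hirr μ hx hμ hy⟩

end ELineConnR

end Summit.HodgeConjecture.HodgeConjecture.Theorems

end
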